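import Mathlib
import HarnessLib

/-!
# The degree-33 Fermat lattice: the Hodge class `(7,10,13,19,22,28)` is not standard-generated
(solo seat `solo-HodgeConjecture-informed`, seventh landing; pure combinatorics, kernel-decided)

**Setting (Shioda 1979, Aoki 1983/1987).** For the Fermat variety `X^n_m : Σ x_i^m = 0` in `ℙ^{n+1}`,
rational Hodge classes of type `(n/2,n/2)` are indexed by characters `β = (b_0,…,b_{n+1})`,
`b_i ∈ ℤ/m ∖ 0`, `Σ b_i = 0`, with `|tβ| = n/2 + 1` for every unit `t` (Ran, Shioda; the set `𝔅^n_m`).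
Aoki (Math. Ann. 266 (1983) §1, §5, Theorem D) packages all `n` at once in the free abelian group
`R_m` on `ℤ/m ∖ 0` (juxtaposition of characters = addition): the Hodge lattice `B_m = Ker θ`
(Stickelberger) satisfies `B_m = S_m + T_m + D_m`, where `S_m` is generated by the
*standard elements* `σ_{p,i}` (one family per prime `p ∣ m`), `D_m` by the pairs `(a) + (-a)`, and
`T_m` by the *semi-standard* elements; Kubert: `2 B_m ⊆ S_m + D_m`. GEOMETRY: pairs are classes of
linear subspaces (Shioda, Ran), `p`-standard elements are classes of Aoki's explicit subvarieties
(J. Math. Soc. Japan? — N. Aoki, *Some new algebraic cycles on Fermat varieties* (1987), Thm 2-1),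
and Shioda's inductive structure gives: `claim(β₁), claim(β₂) ⇒ claim(β₁ * β₂)` and
`claim(β * δ) ⇒ claim(β)` for `δ ∈ 𝔇_m` (Aoki 1987, Thm 1-4). Hence **every Hodge class whose
character lies in `S_m + D_m` is algebraic**, and for semi-standard classes "we have not yet found
such a subvariety except for a few cases" (Aoki 1987, p. 388).

**Degree 33.** G. da Silva Jr. (arXiv:2101.04739, Prop. 3.6) found by computer that Shioda's
condition `(P₃₃)` fails at `α = (7,10,13,19,22,28) ∈ 𝔅⁴₃₃` and called it a candidate
counterexample. This file decides, in the kernel, the sharper lattice facts behind that observation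
(for `m = 33` the standard families are `σ_{3,i} = (i, i+11, i+22, -3i)`, `11 ∤ i`, and
`σ_{11,i} = (i, i+3, …, i+30, -11i)`, `3 ∤ i`):

* `soloInformed_fermat33_nu3_vanishes` / `soloInformed_fermat33_alpha_not_mem` — the parity
  `ν₃(β) = #{i : β_i ∈ {11,22}} mod 2` (number of coordinates of order `3`) is an additive
  invariant vanishing on every standard element and every pair, and `ν₃(α) = 1`; hence
  **`α ∉ S₃₃ + D₃₃`**: no combination of linear subspaces and Aoki's standard cycles, propagated
  through Shioda's inductive structure in any dimension, reaches the class `α`.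
* `soloInformed_fermat33_alpha_append_eq_std11` — **`α * (10·α) = σ_{11,1}`** on the nose: the
  juxtaposition of `α` with its Galois conjugate `10α = (1,4,16,22,25,31)` IS the 11-standard
  character, so `V(α) ⊗ V(10α) ⊂ H¹⁰(X¹⁰₃₃)` is represented by Aoki's cycle.
* `soloInformed_fermat33_alpha_sub_conj_mem`, `soloInformed_fermat33_two_alpha_mem` — an explicit
  22-term juxtaposition identity gives `α - 10α ∈ S₃₃ + D₃₃`, whence `2α ∈ S₃₃ + D₃₃`
  (Kubert's 2-torsion, made explicit), and `10α ∉ S₃₃ + D₃₃` either.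

Together with the seat's exact census (HOME/work/s22: `[B₃₃ : S₃₃ + D₃₃] = 2`; of the 104
unit-orbits of `𝔅⁴₃₃` exactly the orbit of `α` lies outside `S₃₃ + D₃₃`, and it is neither of
pair type, nor of Shioda's `H¹⊗H¹` type, nor `#`-decomposable; for every other `m ≤ 48` the
fourfold lattice `𝔅⁴_m` is exhausted by these known classes) this pins the ENTIRE Hodge conjecture
for all Fermat varieties of degree `33`, in every dimension, on one cycle-existence question:
an algebraic `2`-cycle `Z ⊂ X⁴₃₃` with `P_α[Z] ≠ 0`. The bridge from the lattice facts to that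
statement is the cited literature (not formalised here); what is kernel-checked below is exactly the
finite combinatorics, with no hypotheses.
-/

namespace Summit.HodgeConjecture.HodgeConjecture.Theorems

/-- The vector in Aoki's `R₃₃ = ℤ^{(ℤ/33)∖0}` of a juxtaposition (list) of residues: `a ↦ #{a ∈ L}`.
(Coordinate `0` is junk and is `0` for every list used here.) -/
def soloInformedVec (L : List (ZMod 33)) : ZMod 33 → ℤ := fun a => (L.count a : ℤ)

/-- Juxtaposition of characters is addition in `R₃₃`. -/
lemma soloInformedVec_append (L M : List (ZMod 33)) :
    soloInformedVec (L ++ M) = soloInformedVec L + soloInformedVec M := by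
  funext a; simp [soloInformedVec, List.count_append]

/-- Aoki's `3`-standard element `σ_{3,i} = (i, i+11, i+22, -3i)` of degree `33`. -/
def soloInformedStd3 (i : ZMod 33) : List (ZMod 33) := [i, i + 11, i + 22, -(3 * i)]

/-- Aoki's `11`-standard element `σ_{11,i} = (i, i+3, …, i+30, -11i)` of degree `33`. -/
def soloInformedStd11 (i : ZMod 33) : List (ZMod 33) :=
  (List.range 11).map (fun k => i + 3 * (k : ZMod 33)) ++ [-(11 * i)]

/-- The pair `(a, -a)` (character of a linear subspace). -/
def soloInformedPair (a : ZMod 33) : List (ZMod 33) := [a, -a]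

/-- Generators of `S₃₃ + D₃₃`: the standard elements (with Aoki's side conditions `11 ∤ i`,
resp. `3 ∤ i`) and the pairs `(a,-a)`, `a ≠ 0`. -/
def soloInformedGens33 : Set (ZMod 33 → ℤ) :=
  ({v | ∃ i : ZMod 33, i.val % 11 ≠ 0 ∧ v = soloInformedVec (soloInformedStd3 i)} ∪
   {v | ∃ i : ZMod 33, i.val % 3 ≠ 0 ∧ v = soloInformedVec (soloInformedStd11 i)}) ∪
  {v | ∃ a : ZMod 33, a ≠ 0 ∧ v = soloInformedVec (soloInformedPair a)}

/-- The lattice `S₃₃ + D₃₃ ⊂ R₃₃` of characters reached by standard cycles and linear subspaces. -/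
def soloInformedAokiLattice33 : AddSubgroup (ZMod 33 → ℤ) := AddSubgroup.closure soloInformedGens33

/-- da Silva's character `α = (7,10,13,19,22,28) ∈ 𝔅⁴₃₃`. -/
def soloInformedAlpha33 : List (ZMod 33) := [7, 10, 13, 19, 22, 28]

/-- Its Galois conjugate `10·α = (1,4,16,22,25,31)` (sorted). -/
def soloInformedAlphaConj33 : List (ZMod 33) := [1, 4, 16, 22, 25, 31]

/-- The parity invariant `ν₃(v) = (v 11 + v 22) mod 2`: number of coordinates of order `3`. -/
def soloInformedNu3 : (ZMod 33 → ℤ) →+ ZMod 2 where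
  toFun v := ((v 11 + v 22 : ℤ) : ZMod 2)
  map_zero' := by simp
  map_add' v w := by
    simp only [Pi.add_apply]
    push_cast
    ring

/-- `ν₃` of a juxtaposition counts the coordinates equal to `11` or `22`, mod `2`. -/
lemma soloInformedNu3_vec (L : List (ZMod 33)) :
    soloInformedNu3 (soloInformedVec L) = ((L.count 11 + L.count 22 : ℕ) : ZMod 2) := by
  simp [soloInformedNu3, soloInformedVec]

/-- `ν₃` kills every `3`-standard element (no coordinate is `≡ 0 mod 11`; checked for all `i`). -/
lemma soloInformed_fermat33_nu3_std3 (i : ZMod 33) :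
    soloInformedNu3 (soloInformedVec (soloInformedStd3 i)) = 0 := by
  rw [soloInformedNu3_vec, ZMod.natCast_eq_zero_iff]
  revert i
  decide

/-- `ν₃` kills every `11`-standard element (exactly one `i+3k ≡ 0 mod 11`, plus the entry `-11i`). -/
lemma soloInformed_fermat33_nu3_std11 (i : ZMod 33) :
    soloInformedNu3 (soloInformedVec (soloInformedStd11 i)) = 0 := by
  rw [soloInformedNu3_vec, ZMod.natCast_eq_zero_iff]
  revert i
  decide

/-- `ν₃` kills every pair. -/
lemma soloInformed_fermat33_nu3_pair (a : ZMod 33) :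
    soloInformedNu3 (soloInformedVec (soloInformedPair a)) = 0 := by
  rw [soloInformedNu3_vec, ZMod.natCast_eq_zero_iff]
  revert a
  decide

/-- `ν₃` vanishes on the whole lattice `S₃₃ + D₃₃`. -/
theorem soloInformed_fermat33_nu3_vanishes :
    soloInformedAokiLattice33 ≤ soloInformedNu3.ker := by
  rw [soloInformedAokiLattice33, AddSubgroup.closure_le]
  rintro v ((⟨i, -, rfl⟩ | ⟨i, -, rfl⟩) | ⟨a, -, rfl⟩)
  · exact soloInformed_fermat33_nu3_std3 i
  · exact soloInformed_fermat33_nu3_std11 i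
  · exact soloInformed_fermat33_nu3_pair a

/-- `ν₃(α) = 1`: exactly one coordinate of `α`, namely `22`, has order `3`. -/
lemma soloInformed_fermat33_nu3_alpha :
    soloInformedNu3 (soloInformedVec soloInformedAlpha33) = 1 := by
  rw [soloInformedNu3_vec]
  decide

/-- **`α = (7,10,13,19,22,28)` is not in `S₃₃ + D₃₃`.** -/
theorem soloInformed_fermat33_alpha_not_mem :
    soloInformedVec soloInformedAlpha33 ∉ soloInformedAokiLattice33 := by
  intro h
  have h0 := soloInformed_fermat33_nu3_vanishes h
  rw [AddMonoidHom.mem_ker, soloInformed_fermat33_nu3_alpha] at h0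
  exact one_ne_zero h0

/-- **`α * 10α = σ_{11,1}`**: the juxtaposition of `α` and its conjugate is the `11`-standard character. -/
theorem soloInformed_fermat33_alpha_append_eq_std11 :
    soloInformedVec (soloInformedAlpha33 ++ soloInformedAlphaConj33) =
      soloInformedVec (soloInformedStd11 1) := by
  funext a
  simp only [soloInformedVec, Int.natCast_inj]
  revert a
  decide

/-- Standard elements `σ_{3,i}`, `11 ∤ i`, lie in the lattice. -/
lemma soloInformedVec_mem_of_std3 (i : ZMod 33) (hi : i.val % 11 ≠ 0) :
    soloInformedVec (soloInformedStd3 i) ∈ soloInformedAokiLattice33 :=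
  AddSubgroup.subset_closure (Or.inl (Or.inl ⟨i, hi, rfl⟩))

/-- Standard elements `σ_{11,i}`, `3 ∤ i`, lie in the lattice. -/
lemma soloInformedVec_mem_of_std11 (i : ZMod 33) (hi : i.val % 3 ≠ 0) :
    soloInformedVec (soloInformedStd11 i) ∈ soloInformedAokiLattice33 :=
  AddSubgroup.subset_closure (Or.inl (Or.inr ⟨i, hi, rfl⟩))

/-- Pairs `(a,-a)`, `a ≠ 0`, lie in the lattice. -/
lemma soloInformedVec_mem_of_pair (a : ZMod 33) (ha : a ≠ 0) :
    soloInformedVec (soloInformedPair a) ∈ soloInformedAokiLattice33 :=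
  AddSubgroup.subset_closure (Or.inr ⟨a, ha, rfl⟩)

/-- The explicit 22-term juxtaposition identity
`α * σ_{3,1} * σ_{3,5} * (2,-2)(4,-4)(8,-8)(9,-9) = 10α * σ_{3,2} * σ_{3,7} * σ_{3,8} * (5,-5)(10,-10)`. -/
theorem soloInformed_fermat33_juxtaposition :
    soloInformedVec (soloInformedAlpha33 ++ soloInformedStd3 1 ++ soloInformedStd3 5 ++
        soloInformedPair 2 ++ soloInformedPair 4 ++ soloInformedPair 8 ++ soloInformedPair 9) =
      soloInformedVec (soloInformedAlphaConj33 ++ soloInformedStd3 2 ++ soloInformedStd3 7 ++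
        soloInformedStd3 8 ++ soloInformedPair 5 ++ soloInformedPair 10) := by
  funext a
  simp only [soloInformedVec, Int.natCast_inj]
  revert a
  decide

/-- **`α - 10α ∈ S₃₃ + D₃₃`** (so the Galois orbit of `α` is a single class modulo the lattice). -/
theorem soloInformed_fermat33_alpha_sub_conj_mem :
    soloInformedVec soloInformedAlpha33 - soloInformedVec soloInformedAlphaConj33 ∈
      soloInformedAokiLattice33 := by
  have key := soloInformed_fermat33_juxtaposition
  simp only [soloInformedVec_append] at key
  -- α - α' = (σ_{3,2} + σ_{3,7} + σ_{3,8} + π₅ + π₁₀) - (σ_{3,1} + σ_{3,5} + π₂ + π₄ + π₈ + π₉)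
  have h : soloInformedVec soloInformedAlpha33 - soloInformedVec soloInformedAlphaConj33 =
      (soloInformedVec (soloInformedStd3 2) + soloInformedVec (soloInformedStd3 7) +
        soloInformedVec (soloInformedStd3 8) + soloInformedVec (soloInformedPair 5) +
        soloInformedVec (soloInformedPair 10)) -
      (soloInformedVec (soloInformedStd3 1) + soloInformedVec (soloInformedStd3 5) +
        soloInformedVec (soloInformedPair 2) + soloInformedVec (soloInformedPair 4) +
        soloInformedVec (soloInformedPair 8) + soloInformedVec (soloInformedPair 9)) := by
    rw [sub_eq_sub_iff_add_eq_add]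
    rw [show soloInformedVec soloInformedAlpha33 +
        (soloInformedVec (soloInformedStd3 1) + soloInformedVec (soloInformedStd3 5) +
          soloInformedVec (soloInformedPair 2) + soloInformedVec (soloInformedPair 4) +
          soloInformedVec (soloInformedPair 8) + soloInformedVec (soloInformedPair 9)) =
        soloInformedVec soloInformedAlpha33 + soloInformedVec (soloInformedStd3 1) +
          soloInformedVec (soloInformedStd3 5) + soloInformedVec (soloInformedPair 2) +
          soloInformedVec (soloInformedPair 4) + soloInformedVec (soloInformedPair 8) +
          soloInformedVec (soloInformedPair 9) by abel, key]
    abel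
  rw [h]
  refine sub_mem ?_ ?_
  · refine add_mem (add_mem (add_mem (add_mem ?_ ?_) ?_) ?_) ?_
    · exact soloInformedVec_mem_of_std3 2 (by decide)
    · exact soloInformedVec_mem_of_std3 7 (by decide)
    · exact soloInformedVec_mem_of_std3 8 (by decide)
    · exact soloInformedVec_mem_of_pair 5 (by decide)
    · exact soloInformedVec_mem_of_pair 10 (by decide)
  · refine add_mem (add_mem (add_mem (add_mem (add_mem ?_ ?_) ?_) ?_) ?_) ?_
    · exact soloInformedVec_mem_of_std3 1 (by decide)
    · exact soloInformedVec_mem_of_std3 5 (by decide)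
    · exact soloInformedVec_mem_of_pair 2 (by decide)
    · exact soloInformedVec_mem_of_pair 4 (by decide)
    · exact soloInformedVec_mem_of_pair 8 (by decide)
    · exact soloInformedVec_mem_of_pair 9 (by decide)

/-- **`2α ∈ S₃₃ + D₃₃`** (Kubert's `2`-torsion, explicitly: `2α = (α - 10α) + σ_{11,1}`). -/
theorem soloInformed_fermat33_two_alpha_mem :
    2 • soloInformedVec soloInformedAlpha33 ∈ soloInformedAokiLattice33 := by
  have hsum : soloInformedVec soloInformedAlpha33 + soloInformedVec soloInformedAlphaConj33 ∈
      soloInformedAokiLattice33 := by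
    rw [← soloInformedVec_append, soloInformed_fermat33_alpha_append_eq_std11]
    exact soloInformedVec_mem_of_std11 1 (by decide)
  have := add_mem soloInformed_fermat33_alpha_sub_conj_mem hsum
  convert this using 1
  abel

/-- … and the conjugate `10α` is not in the lattice either. -/
theorem soloInformed_fermat33_alphaConj_not_mem :
    soloInformedVec soloInformedAlphaConj33 ∉ soloInformedAokiLattice33 := by
  intro h
  have := add_mem soloInformed_fermat33_alpha_sub_conj_mem h
  simp only [sub_add_cancel] at this
  exact soloInformed_fermat33_alpha_not_mem this

/-- Summary: modulo `S₃₃ + D₃₃` the class of `α` is a nonzero `2`-torsion element, detected by `ν₃`. -/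
theorem soloInformed_fermat33_summary :
    soloInformedVec soloInformedAlpha33 ∉ soloInformedAokiLattice33 ∧
    2 • soloInformedVec soloInformedAlpha33 ∈ soloInformedAokiLattice33 ∧
    soloInformedVec (soloInformedAlpha33 ++ soloInformedAlphaConj33) =
      soloInformedVec (soloInformedStd11 1) ∧
    soloInformedAokiLattice33 ≤ soloInformedNu3.ker :=
  ⟨soloInformed_fermat33_alpha_not_mem, soloInformed_fermat33_two_alpha_mem,
   soloInformed_fermat33_alpha_append_eq_std11, soloInformed_fermat33_nu3_vanishes⟩

end Summit.HodgeConjecture.HodgeConjecture.Theorems
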